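import Literature.AnabelianGeometry.EtaleTheta.Discharge.Sec2OrbitEmbeddingOuterBinders
import Literature.AnabelianGeometry.EtaleTheta.ThetaCoversOfTypeTempered
import HarnessLib

/-!
# [EtTh] Cor 2.8 (iii), OUTER clauses 3–4: P-C5 for EVERY conjugator REDUCES to P-C5 at ONE reference conjugator
# (index-2 bookkeeping through the automorphism-pair family; proof-only)

Mochizuki, *The Étale Theta Function …* [EtTh], Publ. RIMS 45 (2009), §2, Cor 2.8 (iii), PRIMS PDF p.42 ("if `γ`
arises from an inner automorphism of `Π^tp_{Ċ̲̲}` (resp. `Π^tp_{Ċ̲}`), then `γ` preserves `η̲̈^{Θ,l·ℤ}` (resp.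
`η̈^{Θ,l·ℤ}`)"; proof: "follows immediately from Remark 1.9.1"), Rmk 1.9.1 p.27 ("any inner automorphism of
`Π^tp_{Ċ}` maps `η̈^{Θ,ℤ} ↦ η̈^{Θ,ℤ}`"), Def 1.7 p.27 (`[Π^tp_C : Π^tp_X] = 2`) (bib key `MochizukiEtTh2009`).

PROOF-ONLY companion (no `def`, no instance, no new `Prop`; cell abc-iut, layer L2, seat abc-iut-w6-d049 gen 4, sequel
«P-C5 OUTER REDUCTION TO ONE CONJUGATOR» of R358 / p451471 / p453395) of the OUTER chain for node EtTh:Cor2.8(iii)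
clauses 3–4 (p434590 → p436384 → p436513 → p437630).  After that chain, clause 3 (resp. 4) at
`ThetaOrbitData.ofEmbedding ε hC hS` holds for a conjugator `x ∈ Π^tp_{Ċ̲̲}` (resp. `Π^tp_{Ċ̲}`) with an automorphism
pair `(α, β)` through `ι` modulo Cor 2.8 (iii)'s own binders and **P-C5**: `autMap α⁻¹ β⁻¹ η̈^Θ = conj σ₀ η̈^Θ` with
`σ₀ ∈ Π^tp_{Ẋ̲̲}` (resp. `Π^tp_{Ẋ̲}`) — GAP-LEDGER G-w6d049-1 (model side D-G-w6d049-1, abc-iut-w6-d083).  THIS file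
shows that P-C5 need only be supplied at ONE reference outer conjugator `g₀` of `Π^tp_{Ċ̲̲}` (resp. `Π^tp_{Ċ̲}`), for
automorphism-pair FAMILIES `(α_x, β_x)_{x ∈ Π^tp_C}` through `ι` (`ι ∘ α_x = conj_x ∘ ι`, `β_x ∘ θ = θ ∘ α_x` — the
shape BOTH of abc-iut-L2-d3's constructors give with `α := e.conjX`, `β := topCompanion`, p451471 / p453395):
* §1 (`ContH1Aut`, generic continuous-`H¹` calculus over abc-iut-L6-t1's `autMap`, p-landed
  `CohomologyAutFunctoriality`): `autMap_symm_of_conj_pair` — if `α′ = conj_σ ∘ α` and `β′ = conj_{φσ} ∘ β` then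
  `autMap α′⁻¹ β′⁻¹ c = conj (α⁻¹ σ⁻¹) (autMap α⁻¹ β⁻¹ c)` (cocycle-level identity; the inner case `α = id` is
  abc-iut-w6-d051's `autMap_symm_eq_conj`);
* §2 (`OrbitEmbedding`): the pair family at `ι(y₁)` is `(conj_{y₁}, conj_{θ y₁})` and at `ι(y₁)·x` is
  `(conj_{y₁} ∘ α_x, conj_{θ y₁} ∘ β_x)` (`family_apply_ι`, `family_apply_ι_mul`, `…_theta_…`; `ι` injective,
  `θ` surjective); hence the TRANSPORT IDENTITIES `autMap_family_ι` (`= conj y₁⁻¹`, every class) and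
  `autMap_family_ι_mul` (`= conj (α_x⁻¹ y₁⁻¹) ∘ autMap α_x⁻¹ β_x⁻¹`), with the stability binders of `x` derived from
  those of `ι(y₁)·x` (`family_stabY_of_ι_mul`, `family_stabDelta_of_ι_mul`);
* §3 the junction: `mem_Huu_of_ι_mem_tp_PiCuu` / `mem_GtpXu_of_ι_mem_tp_PiCu` (`ι(y₁) ∈ Π^tp_{C̲̲} ⇒ y₁ ∈ Π^tp_{X̲̲}`,
  resp. `Π^tp_{C̲} ⇒ Π^tp_{X̲}`, granted «`ι(Π^tp_X) ⊆ Π_X`», `hιX`, rfl-grade at both constructors), and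
  `mem_range_or_mul_inv_mem_range` (index-2 dichotomy `x ∈ ι(Π^tp_X) ∨ x·g₀⁻¹ ∈ ι(Π^tp_X)`);
* §4 **`ofEmbedding_transport_outer_rootLZ_of_pC5_at`** / **`ofEmbedding_transport_outer_etaLZ_of_pC5_at`** — clause 3
  (resp. 4) of Cor 2.8 (iii) at `ofEmbedding ε hC hS` for EVERY `x ∈ Π^tp_{Ċ̲̲}` (resp. `Π^tp_{Ċ̲}`) modulo Cor 2.8
  (iii)'s own binders (`Γ_Θ`+`InducesOnTheta`, `hY`, `hYuu`) and P-C5 AT ONE reference outer `g₀ ∈ Π^tp_{Ċ̲̲}`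
  (resp. `Π^tp_{Ċ̲}`) with `σ_{g₀} ∈ Π^tp_{Ẋ̲̲}` (resp. `Π^tp_{Ẋ̲}`): inner `x = ι(y₁)` are free (`σ₀ = y₁⁻¹`), outer
  `x = ι(y₁)·g₀` get `σ₀ = α_{g₀}⁻¹(y₁⁻¹)·σ_{g₀}`, which lies in the dotted group because `y₁ ∈ Π^tp_{X̲̲}` (§3) and
  `α_{g₀}^{±1}` stabilise `Π^tp_{X̲̲}` (abc-iut-w6-d051's `stab_Huu_of_mem_tp_PiCuu`).
HONEST FRAMING: [EtTh] is refereed; statements about the TYPED interface; P-C5 at the reference conjugator stays a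
HYPOTHESIS (model side: abc-iut-w6-d083's `Sec2OuterEtaChiModel`); no side is taken on [IUTchIII] Cor 3.12; typed ≠ proved.
-/

noncomputable section

/-! ## §1. `ContH1Aut`: transport along a pair conjugated on the outside -/

namespace Literature.IUT.HodgeArakelov.ContH1Aut

open Literature.AnabelianGeometry.EtaleTheta

universe u

variable {G : Type u} {G' : Type u} [Group G] [TopologicalSpace G] [IsTopologicalGroup G]
  [Group G'] [TopologicalSpace G'] [IsTopologicalGroup G']
  (φ : G →* G') (A : Subgroup G') [A.Normal] [IsMulCommutative A]

/-- **Transport along a pair conjugated on the outside.** If `α′ = conj_σ ∘ α` and `β′ = conj_{φσ} ∘ β`, then on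
`H¹(H, A)` (`H ⊴ G`) the transport along the inverse pair `(α′⁻¹, β′⁻¹)` is the transport along `(α⁻¹, β⁻¹)`
followed by conjugation by `α⁻¹(σ⁻¹)` — whatever the auxiliary membership proofs.
[cite: NeukirchSchmidtWingberg2008, I §5] -/
theorem autMap_symm_of_conj_pair {H : Subgroup G} [H.Normal] (σ : G)
    (α α' : G ≃ₜ* G) (β β' : G' ≃ₜ* G') (hα' : ∀ g, α' g = σ * α g * σ⁻¹)
    (hβ' : ∀ t, β' t = φ σ * β t * (φ σ)⁻¹)
    (hφ : ∀ g, β.symm (φ g) = φ (α.symm g)) (hA : ∀ a : G', a ∈ A → β.symm a ∈ A)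
    (hH : ∀ x, x ∈ H → α.symm.symm x ∈ H)
    (hφ' : ∀ g, β'.symm (φ g) = φ (α'.symm g)) (hA' : ∀ a : G', a ∈ A → β'.symm a ∈ A)
    (hH' : ∀ x, x ∈ H → α'.symm.symm x ∈ H) (c : ContH1 φ A H) :
    autMap φ A α'.symm β'.symm hφ' hA' hH' c =
      ContH1.conj φ A (α.symm σ⁻¹) (autMap φ A α.symm β.symm hφ hA hH c) := by
  have hβs : ∀ t, β'.symm t = β.symm ((φ σ)⁻¹ * t * φ σ) := fun t => by
    apply β'.injective
    rw [ContinuousMulEquiv.apply_symm_apply, hβ', ContinuousMulEquiv.apply_symm_apply]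
    group
  have hτ : φ (α.symm σ⁻¹) = β.symm (φ σ)⁻¹ := by rw [← map_inv, hφ]
  induction c using QuotientGroup.induction_on with
  | H f =>
    rw [autMap_mk, autMap_mk, ContH1.conj_mk]
    congr 1
    refine Subtype.ext (funext fun h => Subtype.ext ?_)
    rw [coe_autCocycle_apply, ContH1.conjCocycle_apply, MulAut.conjNormal_apply, coe_autCocycle_apply]
    have key : (⟨α'.symm.symm (h : G), hH' h h.2⟩ : H) =
        ⟨α.symm.symm ((MulAut.conjNormal (α.symm σ⁻¹)⁻¹ h : H) : G),
          hH _ (MulAut.conjNormal (α.symm σ⁻¹)⁻¹ h).2⟩ := by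
      apply Subtype.ext
      simp only [ContinuousMulEquiv.symm_symm, MulAut.conjNormal_apply, map_mul, map_inv,
        ContinuousMulEquiv.apply_symm_apply, inv_inv, hα']
    rw [key, hβs, hτ]
    simp only [map_mul, map_inv, inv_inv]

end Literature.IUT.HodgeArakelov.ContH1Aut

namespace Literature.AnabelianGeometry.EtaleTheta

open Literature.AnabelianGeometry.SemiGraphs ThetaCovers Literature.IUT.HodgeArakelov

universe u

/-! ## §2. Automorphism-pair FAMILIES through an orbit embedding -/

namespace ThetaSetting.EtaleThetaData.DoubleUnderline.OrbitEmbedding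

variable {p : ℕ} [Fact p.Prime] {D : ThetaSetting p} {E : D.EtaleThetaData} {l : ℕ}
  {C : E.DoubleUnderline l} {T : TemperedCoverData.{u} l} (ε : C.OrbitEmbedding T)
  {α : T.Gtp → D.PiTemp ≃ₜ* D.PiTemp} {β : T.Gtp → D.GtpTheta ≃ₜ* D.GtpTheta}

/-- At an INNER conjugator `ι(y₁)` the family's first component IS conjugation by `y₁` (`ι` injective).
[cite: MochizukiEtTh2009, Cor 2.8(iii) p.42] -/
theorem family_apply_ι (hα : ∀ x g, ε.ι (α x g) = x * ε.ι g * x⁻¹) (y₁ g : D.PiTemp) :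
    α (ε.ι y₁) g = y₁ * g * y₁⁻¹ :=
  ε.injective_ι (by simp only [hα, map_mul, map_inv])

/-- At `ι(y₁)·x` the family's first component is `conj_{y₁} ∘ α_x` (`ι` injective).
[cite: MochizukiEtTh2009, Cor 2.8(iii) p.42] -/
theorem family_apply_ι_mul (hα : ∀ x g, ε.ι (α x g) = x * ε.ι g * x⁻¹) (y₁ : D.PiTemp) (x : T.Gtp)
    (g : D.PiTemp) : α (ε.ι y₁ * x) g = y₁ * α x g * y₁⁻¹ :=
  ε.injective_ι (by simp only [hα, map_mul, map_inv]; group)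

/-- At `ι(y₁)` the family's theta component is conjugation by `θ(y₁)` (`θ` surjective).
[cite: MochizukiEtTh2009, Thm 1.6 (ii) p.24] -/
theorem family_theta_apply_ι (hα : ∀ x g, ε.ι (α x g) = x * ε.ι g * x⁻¹)
    (hβ : ∀ x g, β x (D.toTheta g) = D.toTheta (α x g)) (y₁ : D.PiTemp) (t : D.GtpTheta) :
    β (ε.ι y₁) t = D.toTheta y₁ * t * (D.toTheta y₁)⁻¹ := by
  obtain ⟨g, rfl⟩ := D.toTheta_surjective t
  rw [hβ, ε.family_apply_ι hα, map_mul, map_mul, map_inv]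

/-- At `ι(y₁)·x` the family's theta component is `conj_{θ y₁} ∘ β_x` (`θ` surjective).
[cite: MochizukiEtTh2009, Thm 1.6 (ii) p.24] -/
theorem family_theta_apply_ι_mul (hα : ∀ x g, ε.ι (α x g) = x * ε.ι g * x⁻¹)
    (hβ : ∀ x g, β x (D.toTheta g) = D.toTheta (α x g)) (y₁ : D.PiTemp) (x : T.Gtp) (t : D.GtpTheta) :
    β (ε.ι y₁ * x) t = D.toTheta y₁ * β x t * (D.toTheta y₁)⁻¹ := by
  obtain ⟨g, rfl⟩ := D.toTheta_surjective t
  rw [hβ, hβ, ε.family_apply_ι_mul hα, map_mul, map_mul, map_inv]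

/-- The `Π^tp_Ÿ`-stability binder of `α_x` follows from that of `α_{ι(y₁)·x}` (`Π^tp_Ÿ ⊴ Π^tp_X`, `Compat`).
[cite: MochizukiEtTh2009, Cor 2.8(iii) p.42] -/
theorem family_stabY_of_ι_mul (hC : D.Compat) (hα : ∀ x g, ε.ι (α x g) = x * ε.ι g * x⁻¹) (y₁ : D.PiTemp)
    (x : T.Gtp) (hY : ∀ g, g ∈ D.GtpYdd → α (ε.ι y₁ * x) g ∈ D.GtpYdd) :
    ∀ g, g ∈ D.GtpYdd → α x g ∈ D.GtpYdd := by
  haveI := hC.GtpYdd_normal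
  intro g hg
  have h := Subgroup.Normal.conj_mem inferInstance _ (hY g hg) y₁⁻¹
  rw [ε.family_apply_ι_mul hα, inv_inv] at h
  have : y₁⁻¹ * (y₁ * α x g * y₁⁻¹) * y₁ = α x g := by group
  rwa [this] at h

/-- The `Δ_Θ`-stability binder of `β_x⁻¹` follows from that of `β_{ι(y₁)·x}⁻¹` (`Δ_Θ ⊴ (Π^tp_X)^Θ`).
[cite: MochizukiEtTh2009, Cor 2.8(iii) p.42] -/
theorem family_stabDelta_of_ι_mul (hα : ∀ x g, ε.ι (α x g) = x * ε.ι g * x⁻¹)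
    (hβ : ∀ x g, β x (D.toTheta g) = D.toTheta (α x g)) (y₁ : D.PiTemp) (x : T.Gtp)
    (hΔ' : ∀ a, a ∈ D.DeltaTheta → (β (ε.ι y₁ * x)).symm a ∈ D.DeltaTheta) :
    ∀ a, a ∈ D.DeltaTheta → (β x).symm a ∈ D.DeltaTheta := by
  intro a ha
  have key : (β x).symm a = (β (ε.ι y₁ * x)).symm (D.toTheta y₁ * a * (D.toTheta y₁)⁻¹) := by
    apply (β (ε.ι y₁ * x)).injective
    rw [ContinuousMulEquiv.apply_symm_apply, ε.family_theta_apply_ι_mul hα hβ,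
      ContinuousMulEquiv.apply_symm_apply]
  rw [key]
  exact hΔ' _ (Subgroup.Normal.conj_mem inferInstance a ha _)

/-- **Transport identity, INNER conjugator**: along the inverse pair at `ι(y₁)` every class of `H¹(Π^tp_Ÿ, Δ_Θ)`
is moved by `conj y₁⁻¹` (abc-iut-w6-d051's `autMap_symm_eq_conj`). [cite: MochizukiEtTh2009, Rmk 1.9.1 p.27] -/
theorem autMap_family_ι (hC : D.Compat) (hα : ∀ x g, ε.ι (α x g) = x * ε.ι g * x⁻¹)
    (hβ : ∀ x g, β x (D.toTheta g) = D.toTheta (α x g)) (y₁ : D.PiTemp)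
    (hΔ' : ∀ a, a ∈ D.DeltaTheta → (β (ε.ι y₁)).symm a ∈ D.DeltaTheta)
    (hY : ∀ g, g ∈ D.GtpYdd → α (ε.ι y₁) g ∈ D.GtpYdd) (η : ContH1 D.toTheta D.DeltaTheta D.GtpYdd) :
    haveI := hC.GtpYdd_normal
    ContH1Aut.autMap D.toTheta D.DeltaTheta (α (ε.ι y₁)).symm (β (ε.ι y₁)).symm
        (symm_toTheta_eq (hβ (ε.ι y₁))) hΔ' (H := D.GtpYdd) (H' := D.GtpYdd) hY η =
      ContH1.conj D.toTheta D.DeltaTheta y₁⁻¹ η := by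
  haveI := hC.GtpYdd_normal
  exact ContH1Aut.autMap_symm_eq_conj D.toTheta D.DeltaTheta y₁ (α (ε.ι y₁)) (ε.family_apply_ι hα y₁)
    (β (ε.ι y₁)) (ε.family_theta_apply_ι hα hβ y₁) _ _ _ η

/-- **Transport identity, `ι(y₁)·x`**: along the inverse pair at `ι(y₁)·x` every class is moved by the inverse
pair at `x` followed by `conj (α_x⁻¹ y₁⁻¹)` (§1). [cite: MochizukiEtTh2009, Rmk 1.9.1 p.27] -/
theorem autMap_family_ι_mul (hC : D.Compat) (hα : ∀ x g, ε.ι (α x g) = x * ε.ι g * x⁻¹)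
    (hβ : ∀ x g, β x (D.toTheta g) = D.toTheta (α x g)) (y₁ : D.PiTemp) (x : T.Gtp)
    (hΔ'x : ∀ a, a ∈ D.DeltaTheta → (β x).symm a ∈ D.DeltaTheta)
    (hYx : ∀ g, g ∈ D.GtpYdd → α x g ∈ D.GtpYdd)
    (hΔ' : ∀ a, a ∈ D.DeltaTheta → (β (ε.ι y₁ * x)).symm a ∈ D.DeltaTheta)
    (hY : ∀ g, g ∈ D.GtpYdd → α (ε.ι y₁ * x) g ∈ D.GtpYdd) (η : ContH1 D.toTheta D.DeltaTheta D.GtpYdd) :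
    haveI := hC.GtpYdd_normal
    ContH1Aut.autMap D.toTheta D.DeltaTheta (α (ε.ι y₁ * x)).symm (β (ε.ι y₁ * x)).symm
        (symm_toTheta_eq (hβ (ε.ι y₁ * x))) hΔ' (H := D.GtpYdd) (H' := D.GtpYdd) hY η =
      ContH1.conj D.toTheta D.DeltaTheta ((α x).symm y₁⁻¹)
        (ContH1Aut.autMap D.toTheta D.DeltaTheta (α x).symm (β x).symm (symm_toTheta_eq (hβ x)) hΔ'x
          (H := D.GtpYdd) (H' := D.GtpYdd) hYx η) := by
  haveI := hC.GtpYdd_normal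
  exact ContH1Aut.autMap_symm_of_conj_pair D.toTheta D.DeltaTheta y₁ (α x) (α (ε.ι y₁ * x)) (β x)
    (β (ε.ι y₁ * x)) (ε.family_apply_ι_mul hα y₁ x) (ε.family_theta_apply_ι_mul hα hβ y₁ x) _ _ _ _ _ _ η

/-! ## §3. The junction: membership bookkeeping -/

/-- **`ι(y₁) ∈ Π^tp_{C̲̲} ⇒ y₁ ∈ Π^tp_{X̲̲}`** (`Π_{X̲̲} = Π_{C̲̲} ∩ Π_X`, `ι(Π^tp_{X̲̲}) = Π^tp_{X̲̲}` of `T`, `ι`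
injective), granted «`ι(Π^tp_X) ⊆ Π_X`». [cite: MochizukiEtTh2009, Def 2.3 p.38] -/
theorem mem_Huu_of_ι_mem_tp_PiCuu (hιX : ∀ σ, ε.ι σ ∈ T.tp T.PiX) {y₁ : D.PiTemp}
    (h : ε.ι y₁ ∈ T.tp T.PiCuu) : y₁ ∈ C.Huu := by
  have h' : ε.ι y₁ ∈ C.Huu.map ε.ι := by
    rw [ε.map_Huu]
    change T.toHat (ε.ι y₁) ∈ T.PiCuu ⊓ T.PiX
    exact Subgroup.mem_inf.2 ⟨h, hιX y₁⟩
  obtain ⟨h₀, hh₀, he⟩ := h'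
  exact ε.injective_ι he ▸ hh₀

/-- **`ι(y₁) ∈ Π^tp_{C̲} ⇒ y₁ ∈ Π^tp_{X̲}`** (`Π_{X̲} = Π_{C̲} ∩ Π_X`, abc-iut-L2-t2's `PiXu_eq_PiCu_inf_PiX`; under
the identification `hXuι : ι(Π^tp_{X̲}) = T.tp T.PiXu`), granted «`ι(Π^tp_X) ⊆ Π_X`». [cite: MochizukiEtTh2009, Def 2.1 p.36] -/
theorem mem_GtpXu_of_ι_mem_tp_PiCu (hXuι : (D.GtpXu l).map ε.ι = T.tp T.PiXu) (hιX : ∀ σ, ε.ι σ ∈ T.tp T.PiX)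
    {y₁ : D.PiTemp} (h : ε.ι y₁ ∈ T.tp T.PiCu) : y₁ ∈ D.GtpXu l := by
  have h' : ε.ι y₁ ∈ (D.GtpXu l).map ε.ι := by
    rw [hXuι]
    change T.toHat (ε.ι y₁) ∈ T.PiXu
    rw [TemperedCoverData.PiXu_eq_PiCu_inf_PiX]
    exact Subgroup.mem_inf.2 ⟨h, hιX y₁⟩
  obtain ⟨h₀, hh₀, he⟩ := h'
  exact ε.injective_ι he ▸ hh₀

/-- **Index-2 dichotomy**: for `g₀ ∉ ι(Π^tp_X)` and `[Π^tp_C : ι(Π^tp_X)] = 2`, every `x ∈ Π^tp_C` lies in `ι(Π^tp_X)` or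
in `ι(Π^tp_X)·g₀`. [cite: MochizukiEtTh2009, Def 1.7 p.27] -/
theorem mem_range_or_mul_inv_mem_range (hidx : ε.ι.range.index = 2) {g₀ : T.Gtp} (hg₀ : g₀ ∉ ε.ι.range)
    (x : T.Gtp) : x ∈ ε.ι.range ∨ x * g₀⁻¹ ∈ ε.ι.range := by
  by_cases hx : x ∈ ε.ι.range
  · exact Or.inl hx
  · refine Or.inr ((Subgroup.mul_mem_iff_of_index_two hidx).2 (iff_of_false hx ?_))
    rwa [inv_mem_iff]

/-! ## §4. Clauses 3–4 of Cor 2.8 (iii) for EVERY conjugator from P-C5 at ONE reference conjugator -/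

/-- **Cor 2.8 (iii), clause 3, for EVERY `x ∈ Π^tp_{Ċ̲̲}` modulo P-C5 at ONE reference outer conjugator.**  For an
automorphism-pair family `(α_x, β_x)` through `ι`, «`ι(Π^tp_X) ⊆ Π_X`», a reference `g₀ ∈ Π^tp_{Ċ̲̲}` with P-C5
`autMap α_{g₀}⁻¹ β_{g₀}⁻¹ η̈^Θ = conj σ_{g₀} η̈^Θ`, `σ_{g₀} ∈ Π^tp_{Ẋ̲̲}`, and any `x ∈ Π^tp_{Ċ̲̲}` with
`x ∈ ι(Π^tp_X) ∪ ι(Π^tp_X)·g₀` carrying Cor 2.8 (iii)'s own binders: `(γ_x, Γ_Θ) · η̲̈^{Θ,l·ℤ} = η̲̈^{Θ,l·ℤ}` at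
`ofEmbedding ε hC hS`. [cite: MochizukiEtTh2009, Cor 2.8(iii) p.42] -/
theorem ofEmbedding_transport_outer_rootLZ_of_pC5_at (hC : D.Compat) (hS : D.Sec2Hyps)
    (hα : ∀ x g, ε.ι (α x g) = x * ε.ι g * x⁻¹) (hβ : ∀ x g, β x (D.toTheta g) = D.toTheta (α x g))
    (hιX : ∀ σ, ε.ι σ ∈ T.tp T.PiX)
    {g₀ : T.Gtp} (hg₀ : g₀ ∈ T.tp T.PiCuu ⊓ T.PiCdot) {σg : D.PiTemp} (hσg : σg ∈ ε.dotXuu)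
    (hη₀ : ∀ (hΔ' : ∀ a, a ∈ D.DeltaTheta → (β g₀).symm a ∈ D.DeltaTheta)
        (hY : ∀ g, g ∈ D.GtpYdd → α g₀ g ∈ D.GtpYdd),
      haveI := hC.GtpYdd_normal
      ContH1Aut.autMap D.toTheta D.DeltaTheta (α g₀).symm (β g₀).symm (symm_toTheta_eq (hβ g₀)) hΔ'
          (H := D.GtpYdd) (H' := D.GtpYdd) hY E.etaDd =
        ContH1.conj D.toTheta D.DeltaTheta σg E.etaDd)
    {x : T.Gtp} (hx : x ∈ T.tp T.PiCuu ⊓ T.PiCdot) (hx₀ : x ∈ ε.ι.range ∨ x * g₀⁻¹ ∈ ε.ι.range)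
    (ΓΘ : (ThetaOrbitData.ofEmbedding ε hC hS).DeltaTheta ≃* (ThetaOrbitData.ofEmbedding ε hC hS).DeltaTheta)
    (hind : (ThetaOrbitData.ofEmbedding ε hC hS).InducesOnTheta (ThetaOrbitData.innerAutTop x) ΓΘ)
    (hYmap : T.PiYddtp.map (ThetaOrbitData.innerAutTop x).toMulEquiv.toMonoidHom = T.PiYddtp)
    (hYuu : (T.PiYddtp ⊓ T.tp T.PiXuu).map (ThetaOrbitData.innerAutTop x).toMulEquiv.toMonoidHom =
      T.PiYddtp ⊓ T.tp T.PiXuu) :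
    (ThetaOrbitData.ofEmbedding ε hC hS).transport _ (ThetaOrbitData.innerAutTop x) hYuu ΓΘ
        (ThetaOrbitData.ofEmbedding ε hC hS).rootLZ =
      (ThetaOrbitData.ofEmbedding ε hC hS).rootLZ := by
  haveI := hC.GtpYdd_normal
  have hxuu := (Subgroup.mem_inf.1 hx).1
  have hxdot := (Subgroup.mem_inf.1 hx).2
  have hg₀uu := (Subgroup.mem_inf.1 hg₀).1
  have hg₀dot := (Subgroup.mem_inf.1 hg₀).2
  obtain ⟨hΔ, hΔ'⟩ := ε.stab_DeltaTheta_of_induces hC hS (hα x) (hβ x) hind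
  obtain ⟨hY, hY'⟩ := ε.stab_GtpYdd_of_map_PiYddtp (hα x) hYmap
  obtain ⟨hU, hU'⟩ := ε.stab_Huu_of_mem_tp_PiCuu (hα x) hxuu
  rcases hx₀ with ⟨y₁, hy₁⟩ | ⟨y₁, hy₁⟩
  · -- INNER conjugator `x = ι y₁`: `σ₀ = y₁⁻¹`
    subst hy₁
    have hy₁U : y₁ ∈ C.Huu := ε.mem_Huu_of_ι_mem_tp_PiCuu hιX hxuu
    exact ε.ofEmbedding_transport_outer_rootLZ hC hS hxdot (hα _) (hβ _) hΔ hΔ' hY hY' hU hU' ΓΘ hind hYuu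
      ⟨C.Huu.inv_mem hy₁U, by rw [map_inv]; exact T.PiCdot.inv_mem hxdot⟩
      (ε.autMap_family_ι hC hα hβ y₁ hΔ' hY E.etaDd)
  · -- OUTER conjugator `x = ι y₁ · g₀`: `σ₀ = α_{g₀}⁻¹(y₁⁻¹) · σ_{g₀}`
    obtain rfl : x = ε.ι y₁ * g₀ := by rw [hy₁, inv_mul_cancel_right]
    have hιy₁uu : ε.ι y₁ ∈ T.tp T.PiCuu := by
      rw [hy₁]; exact (T.tp T.PiCuu).mul_mem hxuu ((T.tp T.PiCuu).inv_mem hg₀uu)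
    have hιy₁dot : ε.ι y₁ ∈ T.PiCdot := by
      rw [hy₁]; exact T.PiCdot.mul_mem hxdot (T.PiCdot.inv_mem hg₀dot)
    have hy₁U : y₁ ∈ C.Huu := ε.mem_Huu_of_ι_mem_tp_PiCuu hιX hιy₁uu
    have hY₀ := ε.family_stabY_of_ι_mul hC hα y₁ g₀ hY
    have hΔ'₀ := ε.family_stabDelta_of_ι_mul hα hβ y₁ g₀ hΔ'
    obtain ⟨-, hU₀'⟩ := ε.stab_Huu_of_mem_tp_PiCuu (hα g₀) hg₀uu
    have hσ₀ : (α g₀).symm y₁⁻¹ * σg ∈ ε.dotXuu := by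
      refine ε.dotXuu_mul_mem ⟨hU₀' _ (C.Huu.inv_mem hy₁U), ?_⟩ hσg
      show ε.ι ((α g₀).symm y₁⁻¹) ∈ T.PiCdot
      rw [ε.ι_symm_eq (hα g₀), map_inv]
      exact T.PiCdot.mul_mem (T.PiCdot.mul_mem (T.PiCdot.inv_mem hg₀dot) (T.PiCdot.inv_mem hιy₁dot)) hg₀dot
    refine ε.ofEmbedding_transport_outer_rootLZ hC hS hxdot (hα _) (hβ _) hΔ hΔ' hY hY' hU hU' ΓΘ hind hYuu
      hσ₀ ?_
    rw [ε.autMap_family_ι_mul hC hα hβ y₁ g₀ hΔ'₀ hY₀ hΔ' hY E.etaDd, hη₀ hΔ'₀ hY₀, ← ContH1.conj_mul_apply]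

/-- **Cor 2.8 (iii), clause 4, for EVERY `x ∈ Π^tp_{Ċ̲}` modulo P-C5 at ONE reference outer conjugator** — the
same for `η̈^{Θ,l·ℤ}` on `Π^tp_Ÿ`, with `Π^tp_{Ċ̲}`, `Π^tp_{Ẋ̲}` in place of `Π^tp_{Ċ̲̲}`, `Π^tp_{Ẋ̲̲}` (under the
identification `hXuι : ι(Π^tp_{X̲}) = T.tp T.PiXu` of clause 2). [cite: MochizukiEtTh2009, Cor 2.8(iii) p.42] -/
theorem ofEmbedding_transport_outer_etaLZ_of_pC5_at (hC : D.Compat) (hS : D.Sec2Hyps)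
    (hα : ∀ x g, ε.ι (α x g) = x * ε.ι g * x⁻¹) (hβ : ∀ x g, β x (D.toTheta g) = D.toTheta (α x g))
    (hXuι : (D.GtpXu l).map ε.ι = T.tp T.PiXu) (hιX : ∀ σ, ε.ι σ ∈ T.tp T.PiX)
    {g₀ : T.Gtp} (hg₀ : g₀ ∈ T.tp T.PiCu ⊓ T.PiCdot) {σg : D.PiTemp} (hσg : σg ∈ ε.dotXu)
    (hη₀ : ∀ (hΔ' : ∀ a, a ∈ D.DeltaTheta → (β g₀).symm a ∈ D.DeltaTheta)
        (hY : ∀ g, g ∈ D.GtpYdd → α g₀ g ∈ D.GtpYdd),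
      haveI := hC.GtpYdd_normal
      ContH1Aut.autMap D.toTheta D.DeltaTheta (α g₀).symm (β g₀).symm (symm_toTheta_eq (hβ g₀)) hΔ'
          (H := D.GtpYdd) (H' := D.GtpYdd) hY E.etaDd =
        ContH1.conj D.toTheta D.DeltaTheta σg E.etaDd)
    {x : T.Gtp} (hx : x ∈ T.tp T.PiCu ⊓ T.PiCdot) (hx₀ : x ∈ ε.ι.range ∨ x * g₀⁻¹ ∈ ε.ι.range)
    (ΓΘ : (ThetaOrbitData.ofEmbedding ε hC hS).DeltaTheta ≃* (ThetaOrbitData.ofEmbedding ε hC hS).DeltaTheta)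
    (hind : (ThetaOrbitData.ofEmbedding ε hC hS).InducesOnTheta (ThetaOrbitData.innerAutTop x) ΓΘ)
    (hYmap : T.PiYddtp.map (ThetaOrbitData.innerAutTop x).toMulEquiv.toMonoidHom = T.PiYddtp) :
    (ThetaOrbitData.ofEmbedding ε hC hS).transport _ (ThetaOrbitData.innerAutTop x) hYmap ΓΘ
        (ThetaOrbitData.ofEmbedding ε hC hS).etaLZ =
      (ThetaOrbitData.ofEmbedding ε hC hS).etaLZ := by
  haveI := hC.GtpYdd_normal
  have hxu := (Subgroup.mem_inf.1 hx).1
  have hxdot := (Subgroup.mem_inf.1 hx).2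
  have hg₀u := (Subgroup.mem_inf.1 hg₀).1
  have hg₀dot := (Subgroup.mem_inf.1 hg₀).2
  obtain ⟨hΔ, hΔ'⟩ := ε.stab_DeltaTheta_of_induces hC hS (hα x) (hβ x) hind
  obtain ⟨hY, hY'⟩ := ε.stab_GtpYdd_of_map_PiYddtp (hα x) hYmap
  obtain ⟨hXu, hXu'⟩ := ε.stab_GtpXu_of_mem_tp_PiCu hXuι (hα x) hxu
  rcases hx₀ with ⟨y₁, hy₁⟩ | ⟨y₁, hy₁⟩
  · -- INNER conjugator `x = ι y₁`: `σ₀ = y₁⁻¹`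
    subst hy₁
    have hy₁U : y₁ ∈ D.GtpXu l := ε.mem_GtpXu_of_ι_mem_tp_PiCu hXuι hιX hxu
    exact ε.ofEmbedding_transport_outer_etaLZ hC hS hxdot (hα _) (hβ _) hΔ hΔ' hY hY' hXu hXu' ΓΘ hind hYmap
      ⟨(D.GtpXu l).inv_mem hy₁U, by rw [map_inv]; exact T.PiCdot.inv_mem hxdot⟩
      (ε.autMap_family_ι hC hα hβ y₁ hΔ' hY E.etaDd)
  · -- OUTER conjugator `x = ι y₁ · g₀`: `σ₀ = α_{g₀}⁻¹(y₁⁻¹) · σ_{g₀}`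
    obtain rfl : x = ε.ι y₁ * g₀ := by rw [hy₁, inv_mul_cancel_right]
    have hιy₁u : ε.ι y₁ ∈ T.tp T.PiCu := by
      rw [hy₁]; exact (T.tp T.PiCu).mul_mem hxu ((T.tp T.PiCu).inv_mem hg₀u)
    have hιy₁dot : ε.ι y₁ ∈ T.PiCdot := by
      rw [hy₁]; exact T.PiCdot.mul_mem hxdot (T.PiCdot.inv_mem hg₀dot)
    have hy₁U : y₁ ∈ D.GtpXu l := ε.mem_GtpXu_of_ι_mem_tp_PiCu hXuι hιX hιy₁u
    have hY₀ := ε.family_stabY_of_ι_mul hC hα y₁ g₀ hY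
    have hΔ'₀ := ε.family_stabDelta_of_ι_mul hα hβ y₁ g₀ hΔ'
    obtain ⟨-, hXu₀'⟩ := ε.stab_GtpXu_of_mem_tp_PiCu hXuι (hα g₀) hg₀u
    have hσ₀ : (α g₀).symm y₁⁻¹ * σg ∈ ε.dotXu := by
      refine ε.dotXu_mul_mem ⟨hXu₀' _ ((D.GtpXu l).inv_mem hy₁U), ?_⟩ hσg
      show ε.ι ((α g₀).symm y₁⁻¹) ∈ T.PiCdot
      rw [ε.ι_symm_eq (hα g₀), map_inv]
      exact T.PiCdot.mul_mem (T.PiCdot.mul_mem (T.PiCdot.inv_mem hg₀dot) (T.PiCdot.inv_mem hιy₁dot)) hg₀dot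
    refine ε.ofEmbedding_transport_outer_etaLZ hC hS hxdot (hα _) (hβ _) hΔ hΔ' hY hY' hXu hXu' ΓΘ hind hYmap
      hσ₀ ?_
    rw [ε.autMap_family_ι_mul hC hα hβ y₁ g₀ hΔ'₀ hY₀ hΔ' hY E.etaDd, hη₀ hΔ'₀ hY₀, ← ContH1.conj_mul_apply]

end ThetaSetting.EtaleThetaData.DoubleUnderline.OrbitEmbedding

end Literature.AnabelianGeometry.EtaleTheta

end
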